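import Mathlib.RingTheory.Ideal.Span
import Mathlib.RingTheory.Ideal.Prime
import Mathlib.Algebra.CharP.Lemmas
import Mathlib.Tactic.LinearCombination
import Mathlib.Tactic.Ring
import HarnessLib

/-!
# Crux `Steer` (stmt-ResolutionOfSingularities-16345), chain W4.1, odd branch (Par-O) — brick (P1): GENERIC ODDNESS of a
# divisor PERSISTS along point steps and strips (characteristic-2 identities; Theses-free, def-free research support)

OURS (campaign `res-hironaka`, rung L ★L-G4, slot W4.1; statements about the route's own objects; they replace the
role of no printed item and are NOT statements of the manuscript under review [claim: Hironaka2017, status: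
under-review]; AI review is weaker than expert review). Seat res-D-pv-003 (gen 6) on res-L0-w41-plan-1 RULING 108c
(«(P1) a tail-born odd divisor stays odd under strips / free point steps»); argument res-L0-w41-tri-1 g5 PREREG-FB v1.6
D·S6 step 1 (parity invariance). Companion of `…OddBranchParity.lean` (§1 (P2-loc): GENERIC ⇒ LOCAL square residue on a
regular member; §2 (P2) `isPermissibleCentre_of_two_generic_odd` consumes exactly the generic form produced here).

## The currency

«`f` is GENERICALLY A SQUARE modulo the divisor `V(y)`» := `∃ a s, s ∉ (y) ∧ s² f − a² ∈ (y)` (a square in the residue field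
of the DVR of `V(y)`; def-free, as in `OddBranchParity`). At a post-strip stage this is «clord_{V(y)} f ≥ 1», i.e. (N4: no
singular divisor) the divisor is ODD.

## The identities (characteristic 2)

* `generic_sq_step`: if `s² f − a² ∈ (y)` and `z² f' = f + g²` (one STRICT-TRANSFORM step of the torsor generator,
  `s' = (s + g)/z`, read on the radicands: a point step with exceptional parameter `z`, or a strip with `z = π`), then
  `(s z)² f' − (a + s g)² ∈ (y)` — generic squareness passes to `f'` with the new denominator `s z` (`∉ (y)` when `(y)` is
  prime and `s, z ∉ (y)`: `mul_not_mem_of_isPrime`).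
* `generic_sq_of_strictTransform`: the OLD divisor `V(x)` read on its strict transform `V(y)`, `x = u·y`: from
  `s² f₀ − a² ∈ (x)` and `u² f₁ = f₀ + g²` get `(s u)² f₁ − (a + s g)² ∈ (y)`.
* `generic_sq_of_oddShape`: the NEW divisor of an odd point step after its strips, `f = h² + u·G` ⇒ `1² f − h² ∈ (u)`.
* `generic_sq_iterate`: along finitely many steps `z_k² f_{k+1} = f_k + g_k²` with all `z_k ∉ (y)`, `(y)` prime, generic
  squareness modulo `y` of `f_0` passes to `f_N`.

So between two point steps of the odd branch both divisors through the next centre — the new `V(u)` and the strict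
transform `V(x/u)` of the previous one — are generically odd at the post-strip stage, which is the input of
`OddBranchParity.isPermissibleCentre_of_two_generic_odd` (with `OddBranchRsop.isRsopPart_excParam_strictTransform` for
the normal crossing). No Theses file is imported; nothing here is a route item or a registration. [folklore]
-/

noncomputable section

-- `Summit.<S>.<S>.…` duplicates the summit name by design (single-problem summit).
set_option linter.dupNamespace false

namespace Summit.ResolutionOfSingularities.ResolutionOfSingularities.Theorems.SwitchingDichotomy.OddBranchParity

variable {B : Type*} [CommRing B]

/-- In a prime ideal, a product of non-members is a non-member. [folklore] -/
theorem mul_not_mem_of_isPrime {P : Ideal B} [P.IsPrime] {s z : B} (hs : s ∉ P) (hz : z ∉ P) : s * z ∉ P :=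
  fun h => (Ideal.IsPrime.mem_or_mem ‹_› h).elim hs hz

/-- `(x) ⊆ (y)` when `x = u·y`. [folklore] -/
theorem span_singleton_le_of_eq_mul {x u y : B} (hx : x = u * y) : Ideal.span ({x} : Set B) ≤ Ideal.span {y} := by
  rw [Ideal.span_singleton_le_iff_mem, hx]
  exact Ideal.mul_mem_left _ _ (Ideal.mem_span_singleton_self y)

variable [CharP B 2]

/-- **One step** (characteristic `2`): generic squareness modulo `y` passes along `z² f' = f + g²`:
`s² f − a² ∈ (y)` ⇒ `(s z)² f' − (a + s g)² ∈ (y)`, since `(s z)² f' = s² f + (s g)²` and `(a + s g)² = a² + (s g)²`.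
[folklore] -/
theorem generic_sq_step {y f f' g z a s : B} (hgen : s ^ 2 * f - a ^ 2 ∈ Ideal.span ({y} : Set B))
    (hstep : z ^ 2 * f' = f + g ^ 2) : (s * z) ^ 2 * f' - (a + s * g) ^ 2 ∈ Ideal.span ({y} : Set B) := by
  have h2 : (2 : B) = 0 := by
    have := CharP.cast_eq_zero B 2
    simpa using this
  have key : (s * z) ^ 2 * f' - (a + s * g) ^ 2 = s ^ 2 * f - a ^ 2 := by
    have hzf : (s * z) ^ 2 * f' = s ^ 2 * (f + g ^ 2) := by rw [← hstep]; ring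
    rw [hzf]
    linear_combination (-(a * s * g)) * h2
  rw [key]
  exact hgen

/-- **The old divisor on its strict transform.** With `x = u·y` (`V(y)` the strict transform of `V(x)` in the transform,
`u` the exceptional parameter) and the point-step relation `u² f₁ = f₀ + g²`: `s² f₀ − a² ∈ (x)` ⇒
`(s u)² f₁ − (a + s g)² ∈ (y)`. [folklore] -/
theorem generic_sq_of_strictTransform {x u y f₀ f₁ g a s : B} (hx : x = u * y)
    (hgen : s ^ 2 * f₀ - a ^ 2 ∈ Ideal.span ({x} : Set B)) (hstep : u ^ 2 * f₁ = f₀ + g ^ 2) :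
    (s * u) ^ 2 * f₁ - (a + s * g) ^ 2 ∈ Ideal.span ({y} : Set B) :=
  generic_sq_step (span_singleton_le_of_eq_mul hx hgen) hstep

/-- **The old divisor, local form at the previous stage** (`f₀ = h² + x·G`, D·S5 shape) read on its strict transform:
`u² f₁ − (h + g)² ∈ (y)`. [folklore] -/
theorem generic_sq_of_strictTransform_oddShape {x u y f₀ f₁ g h G : B} (hx : x = u * y) (hf₀ : f₀ = h ^ 2 + x * G)
    (hstep : u ^ 2 * f₁ = f₀ + g ^ 2) : (1 * u) ^ 2 * f₁ - (h + 1 * g) ^ 2 ∈ Ideal.span ({y} : Set B) := by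
  refine generic_sq_of_strictTransform hx ?_ hstep
  rw [hf₀]
  have : (1 : B) ^ 2 * (h ^ 2 + x * G) - h ^ 2 = G * x := by ring
  rw [this]
  exact Ideal.mul_mem_left _ _ (Ideal.mem_span_singleton_self x)

omit [CharP B 2] in
/-- **The new divisor** of an odd point step after its strips (`f = h² + u·G`): `f` is a square modulo `u` with
denominator `1`. [folklore] -/
theorem generic_sq_of_oddShape {u f h G : B} (hf : f = h ^ 2 + u * G) :
    (1 : B) ^ 2 * f - h ^ 2 ∈ Ideal.span ({u} : Set B) := by
  rw [hf]
  have : (1 : B) ^ 2 * (h ^ 2 + u * G) - h ^ 2 = G * u := by ring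
  rw [this]
  exact Ideal.mul_mem_left _ _ (Ideal.mem_span_singleton_self u)

/-- **Iteration along finitely many steps** (the strips between two point steps, or any block): if
`z_k² f_{k+1} = f_k + g_k²` for `k < N` with every `z_k ∉ (y)`, `(y)` prime, and `f_0` is generically a square modulo `y`,
then so is `f_N`. [folklore] -/
theorem generic_sq_iterate {y : B} [(Ideal.span ({y} : Set B)).IsPrime] (f g z : ℕ → B) (N : ℕ)
    (hstep : ∀ k < N, z k ^ 2 * f (k + 1) = f k + g k ^ 2) (hz : ∀ k < N, z k ∉ Ideal.span ({y} : Set B))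
    (h0 : ∃ a s : B, s ∉ Ideal.span ({y} : Set B) ∧ s ^ 2 * f 0 - a ^ 2 ∈ Ideal.span ({y} : Set B)) :
    ∃ a s : B, s ∉ Ideal.span ({y} : Set B) ∧ s ^ 2 * f N - a ^ 2 ∈ Ideal.span ({y} : Set B) := by
  induction N with
  | zero => exact h0
  | succ N ih =>
    obtain ⟨a, s, hs, hgen⟩ := ih (fun k hk => hstep k (Nat.lt_succ_of_lt hk)) (fun k hk => hz k (Nat.lt_succ_of_lt hk))
    exact ⟨a + s * g N, s * z N, mul_not_mem_of_isPrime hs (hz N (Nat.lt_succ_self N)),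
      generic_sq_step hgen (hstep N (Nat.lt_succ_self N))⟩

/-- **Iteration, started from the strict transform of an odd divisor**: `x = u·y`, `f₀ = h² + x·G` at the previous
stage, the point step `u² · f 0 = f₀ + g₀²`, then steps `z_k² f_{k+1} = f_k + g_k²` (`k < N`) with `u, z_k ∉ (y)`, `(y)` prime
⇒ `f_N` is generically a square modulo `y`. [folklore] -/
theorem generic_sq_iterate_of_oddShape {x u y f₀ g₀ h G : B} [(Ideal.span ({y} : Set B)).IsPrime] (hx : x = u * y)
    (hf₀ : f₀ = h ^ 2 + x * G) (hu : u ∉ Ideal.span ({y} : Set B)) (f g z : ℕ → B) (hstart : u ^ 2 * f 0 = f₀ + g₀ ^ 2)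
    (N : ℕ) (hstep : ∀ k < N, z k ^ 2 * f (k + 1) = f k + g k ^ 2) (hz : ∀ k < N, z k ∉ Ideal.span ({y} : Set B)) :
    ∃ a s : B, s ∉ Ideal.span ({y} : Set B) ∧ s ^ 2 * f N - a ^ 2 ∈ Ideal.span ({y} : Set B) := by
  refine generic_sq_iterate f g z N hstep hz ⟨h + 1 * g₀, 1 * u, ?_, ?_⟩
  · rw [one_mul]; exact hu
  · exact generic_sq_of_strictTransform_oddShape hx hf₀ hstart

end Summit.ResolutionOfSingularities.ResolutionOfSingularities.Theorems.SwitchingDichotomy.OddBranchParity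

end
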